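import Mathlib
import Summits.NavierStokesRegularity.NavierStokesRegularity.Theorems.OrthantWakeOrthantTableStructure
import HarnessLib

/-!
# The tuned pump ladders are ADMISSIBLE KP networks proper of `E₂(8)` at every scale ratio
(helper file for crux stmt-NavierStokesRegularity-27057 `SubOnsagerCeiling.ForwardTailCeilingKP`,
`--supports … --as helper`; companion of `SubOnsagerCeilingKPPumpLadder`)

The ladder class of `SubOnsagerCeilingKPPumpLadder` (in-shell pumps `0→1→2→3` with weights `P₀, P₁, P₂`, one
forward feed `3→0` with weight `f`, Katz–Pavlović back-reactions, nothing else) embeds the positive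
Katz–Pavlović chain at the scale ratio `(1+ε₀)^{1/4}` when the weights are TUNED:
`P_j = (1+ε₀)^{-(15-5j)/8}`, `f = 1`.  This file shows that such tables EXIST inside the hypotheses of the
crux / of the registered stubs at EVERY `ε₀ ∈ (0, 1]`: any table with the closed forms below and weights
`P_j ∈ [1/4, 1]` is symmetric (4.2), cancelling (4.3), `8`-comparable (non-zero moduli `≥ P_j/2 ≥ 1/8`), ORTHANT
(via `orthant_iff_coefficients`) and has diagonal feeds (`ladderW_symmetric`, `ladderW_cancelling`, `ladderW_inTableClass`, `ladderW_orthant`, `ladderW_struct`); `pumpLadder_tuned_weights` checks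
`(1+ε₀)^{-(15-5j)/8} ∈ [1/4, 1]` for `ε₀ ∈ (0, 1]`, and `pumpLadder_nonempty` packages the existence statement
together with the tuning identities `P_j·(1+ε₀)^{5n/2} = c·B^{5(4n+j)/2}`, `f·(1+ε₀)^{5n/2} = c·B^{5(4n+3)/2}`
(`c = (1+ε₀)^{-15/8}`, `B = (1+ε₀)^{1/4}`): the bond coefficients of the embedded chain are those of the
standard chain at ratio `B`.  MODEL lattice algebra; nothing here bears on Navier–Stokes regularity.
[cite: Tao2016AveragedNS, §4 (4.2)–(4.3); §6.1 (comparable tables)]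
-/

noncomputable section

-- the sub-problem namespace `NavierStokesRegularity.NavierStokesRegularity` is the tree's layout (D-0017)
set_option linter.dupNamespace false

namespace Summit.NavierStokesRegularity.NavierStokesRegularity.Theorems

open Literature.Analysis.FluidPDE.TaoCascade

section LadderW

variable {α : Fin 4 → Fin 4 → Fin 4 → ℤ × ℤ × ℤ → ℝ} {p₀ p₁ p₂ : ℝ}

/-- Symmetry (4.2) of a ladder table (entries given in closed form on the four shifts). [this file] -/
theorem ladderW_symmetric
    (hfeed : ∀ i₁ i₂ i₃ : Fin 4, α i₁ i₂ i₃ ((0 : ℤ), (0 : ℤ), (1 : ℤ)) =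
      if i₁ = 3 ∧ i₂ = 3 ∧ i₃ = 0 then (1 : ℝ) else 0)
    (hup1 : ∀ i₁ i₂ i₃ : Fin 4, α i₁ i₂ i₃ ((1 : ℤ), (0 : ℤ), (0 : ℤ)) =
      if i₁ = 0 ∧ i₂ = 3 ∧ i₃ = 3 then (-(1 / 2) : ℝ) else 0)
    (hup2 : ∀ i₁ i₂ i₃ : Fin 4, α i₁ i₂ i₃ ((0 : ℤ), (1 : ℤ), (0 : ℤ)) =
      if i₁ = 3 ∧ i₂ = 0 ∧ i₃ = 3 then (-(1 / 2) : ℝ) else 0)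
    (hin : ∀ i₁ i₂ i₃ : Fin 4, α i₁ i₂ i₃ ((0 : ℤ), (0 : ℤ), (0 : ℤ)) =
      (if i₁ = 0 ∧ i₂ = 0 ∧ i₃ = 1 then p₀ else 0) + (if i₁ = 1 ∧ i₂ = 1 ∧ i₃ = 2 then p₁ else 0) +
        (if i₁ = 2 ∧ i₂ = 2 ∧ i₃ = 3 then p₂ else 0) +
        (if (i₁ = 0 ∧ i₂ = 1 ∧ i₃ = 0) ∨ (i₁ = 1 ∧ i₂ = 0 ∧ i₃ = 0) then -p₀ / 2 else 0) +
        (if (i₁ = 1 ∧ i₂ = 2 ∧ i₃ = 1) ∨ (i₁ = 2 ∧ i₂ = 1 ∧ i₃ = 1) then -p₁ / 2 else 0) +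
        (if (i₁ = 2 ∧ i₂ = 3 ∧ i₃ = 2) ∨ (i₁ = 3 ∧ i₂ = 2 ∧ i₃ = 2) then -p₂ / 2 else 0)) :
    IsSymmetricCoeff α := by
  intro i₁ i₂ i₃ μ₁ μ₂ μ₃ hμ
  rw [mem_shiftSet_iff] at hμ
  simp only [Prod.mk.injEq] at hμ
  rcases hμ with ⟨rfl, rfl, rfl⟩ | ⟨rfl, rfl, rfl⟩ | ⟨rfl, rfl, rfl⟩ | ⟨rfl, rfl, rfl⟩
  · simp only [hin]
    fin_cases i₁ <;> fin_cases i₂ <;> fin_cases i₃ <;> simp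
  · simp only [hup1, hup2]
    fin_cases i₁ <;> fin_cases i₂ <;> fin_cases i₃ <;> simp
  · simp only [hup1, hup2]
    fin_cases i₁ <;> fin_cases i₂ <;> fin_cases i₃ <;> simp
  · simp only [hfeed]
    fin_cases i₁ <;> fin_cases i₂ <;> fin_cases i₃ <;> simp

/-- Cancellation (4.3) of a ladder table. [this file] -/
theorem ladderW_cancelling
    (hfeed : ∀ i₁ i₂ i₃ : Fin 4, α i₁ i₂ i₃ ((0 : ℤ), (0 : ℤ), (1 : ℤ)) =
      if i₁ = 3 ∧ i₂ = 3 ∧ i₃ = 0 then (1 : ℝ) else 0)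
    (hup1 : ∀ i₁ i₂ i₃ : Fin 4, α i₁ i₂ i₃ ((1 : ℤ), (0 : ℤ), (0 : ℤ)) =
      if i₁ = 0 ∧ i₂ = 3 ∧ i₃ = 3 then (-(1 / 2) : ℝ) else 0)
    (hup2 : ∀ i₁ i₂ i₃ : Fin 4, α i₁ i₂ i₃ ((0 : ℤ), (1 : ℤ), (0 : ℤ)) =
      if i₁ = 3 ∧ i₂ = 0 ∧ i₃ = 3 then (-(1 / 2) : ℝ) else 0)
    (hin : ∀ i₁ i₂ i₃ : Fin 4, α i₁ i₂ i₃ ((0 : ℤ), (0 : ℤ), (0 : ℤ)) =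
      (if i₁ = 0 ∧ i₂ = 0 ∧ i₃ = 1 then p₀ else 0) + (if i₁ = 1 ∧ i₂ = 1 ∧ i₃ = 2 then p₁ else 0) +
        (if i₁ = 2 ∧ i₂ = 2 ∧ i₃ = 3 then p₂ else 0) +
        (if (i₁ = 0 ∧ i₂ = 1 ∧ i₃ = 0) ∨ (i₁ = 1 ∧ i₂ = 0 ∧ i₃ = 0) then -p₀ / 2 else 0) +
        (if (i₁ = 1 ∧ i₂ = 2 ∧ i₃ = 1) ∨ (i₁ = 2 ∧ i₂ = 1 ∧ i₃ = 1) then -p₁ / 2 else 0) +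
        (if (i₁ = 2 ∧ i₂ = 3 ∧ i₃ = 2) ∨ (i₁ = 3 ∧ i₂ = 2 ∧ i₃ = 2) then -p₂ / 2 else 0)) :
    IsCancellingCoeff α := by
  intro i₁ i₂ i₃ μ₁ μ₂ μ₃ hμ
  rw [mem_shiftSet_iff] at hμ
  simp only [Prod.mk.injEq] at hμ
  rcases hμ with ⟨rfl, rfl, rfl⟩ | ⟨rfl, rfl, rfl⟩ | ⟨rfl, rfl, rfl⟩ | ⟨rfl, rfl, rfl⟩ <;>
    simp only [hin, hfeed, hup1, hup2] <;>
    fin_cases i₁ <;> fin_cases i₂ <;> fin_cases i₃ <;> simp <;> ring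

/-- **A ladder table with pump weights in `[1/4, 1]` belongs to `E₂(8)`**: symmetric (4.2), cancelling (4.3),
`8`-comparable (moduli `≤ 1`, non-zero moduli `≥ P_j/2 ≥ 1/8`). [this file] -/
theorem ladderW_inTableClass
    (hfeed : ∀ i₁ i₂ i₃ : Fin 4, α i₁ i₂ i₃ ((0 : ℤ), (0 : ℤ), (1 : ℤ)) =
      if i₁ = 3 ∧ i₂ = 3 ∧ i₃ = 0 then (1 : ℝ) else 0)
    (hup1 : ∀ i₁ i₂ i₃ : Fin 4, α i₁ i₂ i₃ ((1 : ℤ), (0 : ℤ), (0 : ℤ)) =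
      if i₁ = 0 ∧ i₂ = 3 ∧ i₃ = 3 then (-(1 / 2) : ℝ) else 0)
    (hup2 : ∀ i₁ i₂ i₃ : Fin 4, α i₁ i₂ i₃ ((0 : ℤ), (1 : ℤ), (0 : ℤ)) =
      if i₁ = 3 ∧ i₂ = 0 ∧ i₃ = 3 then (-(1 / 2) : ℝ) else 0)
    (hin : ∀ i₁ i₂ i₃ : Fin 4, α i₁ i₂ i₃ ((0 : ℤ), (0 : ℤ), (0 : ℤ)) =
      (if i₁ = 0 ∧ i₂ = 0 ∧ i₃ = 1 then p₀ else 0) + (if i₁ = 1 ∧ i₂ = 1 ∧ i₃ = 2 then p₁ else 0) +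
        (if i₁ = 2 ∧ i₂ = 2 ∧ i₃ = 3 then p₂ else 0) +
        (if (i₁ = 0 ∧ i₂ = 1 ∧ i₃ = 0) ∨ (i₁ = 1 ∧ i₂ = 0 ∧ i₃ = 0) then -p₀ / 2 else 0) +
        (if (i₁ = 1 ∧ i₂ = 2 ∧ i₃ = 1) ∨ (i₁ = 2 ∧ i₂ = 1 ∧ i₃ = 1) then -p₁ / 2 else 0) +
        (if (i₁ = 2 ∧ i₂ = 3 ∧ i₃ = 2) ∨ (i₁ = 3 ∧ i₂ = 2 ∧ i₃ = 2) then -p₂ / 2 else 0))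
    (h0 : 1 / 4 ≤ p₀ ∧ p₀ ≤ 1) (h1 : 1 / 4 ≤ p₁ ∧ p₁ ≤ 1) (h2 : 1 / 4 ≤ p₂ ∧ p₂ ≤ 1) :
    Literature.Analysis.FluidPDE.TaoCascade.InTableClass 8 α := by
  have a0 : |p₀| = p₀ := abs_of_pos (by linarith [h0.1])
  have a1 : |p₁| = p₁ := abs_of_pos (by linarith [h1.1])
  have a2 : |p₂| = p₂ := abs_of_pos (by linarith [h2.1])
  have e0 : |p₀| ≤ 1 ∧ (p₀ = 0 ∨ (8 : ℝ)⁻¹ ≤ |p₀|) := ⟨by rw [a0]; exact h0.2, Or.inr (by rw [a0]; linarith [h0.1])⟩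
  have e1 : |p₁| ≤ 1 ∧ (p₁ = 0 ∨ (8 : ℝ)⁻¹ ≤ |p₁|) := ⟨by rw [a1]; exact h1.2, Or.inr (by rw [a1]; linarith [h1.1])⟩
  have e2 : |p₂| ≤ 1 ∧ (p₂ = 0 ∨ (8 : ℝ)⁻¹ ≤ |p₂|) := ⟨by rw [a2]; exact h2.2, Or.inr (by rw [a2]; linarith [h2.1])⟩
  have b0 : |-p₀ / 2| = p₀ / 2 := by rw [neg_div, abs_neg, abs_div, a0, abs_two]
  have b1 : |-p₁ / 2| = p₁ / 2 := by rw [neg_div, abs_neg, abs_div, a1, abs_two]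
  have b2 : |-p₂ / 2| = p₂ / 2 := by rw [neg_div, abs_neg, abs_div, a2, abs_two]
  have d0 : |-p₀ / 2| ≤ 1 ∧ (p₀ = 0 ∨ (8 : ℝ)⁻¹ ≤ |-p₀ / 2|) :=
    ⟨by rw [b0]; linarith [h0.2], Or.inr (by rw [b0]; linarith [h0.1])⟩
  have d1 : |-p₁ / 2| ≤ 1 ∧ (p₁ = 0 ∨ (8 : ℝ)⁻¹ ≤ |-p₁ / 2|) :=
    ⟨by rw [b1]; linarith [h1.2], Or.inr (by rw [b1]; linarith [h1.1])⟩
  have d2 : |-p₂ / 2| ≤ 1 ∧ (p₂ = 0 ∨ (8 : ℝ)⁻¹ ≤ |-p₂ / 2|) :=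
    ⟨by rw [b2]; linarith [h2.2], Or.inr (by rw [b2]; linarith [h2.1])⟩
  have hcmp : IsComparableCoeff 8 α := by
    intro i₁ i₂ i₃ μ hμ
    rw [mem_shiftSet_iff] at hμ
    rcases hμ with rfl | rfl | rfl | rfl <;>
      simp only [hin, hfeed, hup1, hup2] <;>
      fin_cases i₁ <;> fin_cases i₂ <;> fin_cases i₃ <;> simp <;>
      first | exact e0 | exact e1 | exact e2 | exact d0 | exact d1 | exact d2 | norm_num
  exact ⟨ladderW_symmetric hfeed hup1 hup2 hin, ladderW_cancelling hfeed hup1 hup2 hin, hcmp⟩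

/-- The orthant (Kamke) hypothesis of the crux for a ladder table with non-negative pump weights, via
`orthant_iff_coefficients`. [this file] -/
theorem ladderW_orthant
    (hfeed : ∀ i₁ i₂ i₃ : Fin 4, α i₁ i₂ i₃ ((0 : ℤ), (0 : ℤ), (1 : ℤ)) =
      if i₁ = 3 ∧ i₂ = 3 ∧ i₃ = 0 then (1 : ℝ) else 0)
    (hup1 : ∀ i₁ i₂ i₃ : Fin 4, α i₁ i₂ i₃ ((1 : ℤ), (0 : ℤ), (0 : ℤ)) =
      if i₁ = 0 ∧ i₂ = 3 ∧ i₃ = 3 then (-(1 / 2) : ℝ) else 0)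
    (hup2 : ∀ i₁ i₂ i₃ : Fin 4, α i₁ i₂ i₃ ((0 : ℤ), (1 : ℤ), (0 : ℤ)) =
      if i₁ = 3 ∧ i₂ = 0 ∧ i₃ = 3 then (-(1 / 2) : ℝ) else 0)
    (hin : ∀ i₁ i₂ i₃ : Fin 4, α i₁ i₂ i₃ ((0 : ℤ), (0 : ℤ), (0 : ℤ)) =
      (if i₁ = 0 ∧ i₂ = 0 ∧ i₃ = 1 then p₀ else 0) + (if i₁ = 1 ∧ i₂ = 1 ∧ i₃ = 2 then p₁ else 0) +
        (if i₁ = 2 ∧ i₂ = 2 ∧ i₃ = 3 then p₂ else 0) +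
        (if (i₁ = 0 ∧ i₂ = 1 ∧ i₃ = 0) ∨ (i₁ = 1 ∧ i₂ = 0 ∧ i₃ = 0) then -p₀ / 2 else 0) +
        (if (i₁ = 1 ∧ i₂ = 2 ∧ i₃ = 1) ∨ (i₁ = 2 ∧ i₂ = 1 ∧ i₃ = 1) then -p₁ / 2 else 0) +
        (if (i₁ = 2 ∧ i₂ = 3 ∧ i₃ = 2) ∨ (i₁ = 3 ∧ i₂ = 2 ∧ i₃ = 2) then -p₂ / 2 else 0))
    (h0 : 0 ≤ p₀) (h1 : 0 ≤ p₁) (h2 : 0 ≤ p₂) :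
    ∀ (Y : Fin 4 → ℤ → ℝ → ℝ) (τ : ℝ), (∀ (j : Fin 4) (k : ℤ), 1 ≤ k → 0 ≤ Y j k τ) →
      ∀ δ : ℝ, 0 < δ → ∀ (i : Fin 4) (n : ℤ), 1 ≤ n → Y i n τ = 0 → 0 ≤ quadTerm δ α Y i n τ := by
  rw [orthant_iff_coefficients]
  refine ⟨?_, ?_, ?_⟩
  · intro i w
    simp only [hfeed, Fin.sum_univ_four]
    fin_cases i <;> simp
    nlinarith [mul_self_nonneg (w 3)]
  · intro i a b hbi
    simp only [hup1, hup2]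
    fin_cases i <;> fin_cases a <;> fin_cases b <;> simp at hbi ⊢
  · intro i y hy hyi
    simp only [hin, Fin.sum_univ_four]
    fin_cases i <;> simp at hyi ⊢ <;>
      nlinarith [mul_nonneg h0 (mul_self_nonneg (y 0)), mul_nonneg h1 (mul_self_nonneg (y 1)),
        mul_nonneg h2 (mul_self_nonneg (y 2)), mul_eq_zero_of_left hyi (p₀ * y 1),
        mul_eq_zero_of_left hyi (p₁ * y 2), mul_eq_zero_of_left hyi (p₂ * y 3)]

/-- The structural hypotheses of the ladder class (`SubOnsagerCeilingKPPumpLadder`): diagonal feed forms, the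
feed table `hw` with `f = 1`, the pump table `hP` with weights `p₀, p₁, p₂`, no differential in-shell triads
`hCz`. [this file] -/
theorem ladderW_struct
    (hfeed : ∀ i₁ i₂ i₃ : Fin 4, α i₁ i₂ i₃ ((0 : ℤ), (0 : ℤ), (1 : ℤ)) =
      if i₁ = 3 ∧ i₂ = 3 ∧ i₃ = 0 then (1 : ℝ) else 0)
    (hin : ∀ i₁ i₂ i₃ : Fin 4, α i₁ i₂ i₃ ((0 : ℤ), (0 : ℤ), (0 : ℤ)) =
      (if i₁ = 0 ∧ i₂ = 0 ∧ i₃ = 1 then p₀ else 0) + (if i₁ = 1 ∧ i₂ = 1 ∧ i₃ = 2 then p₁ else 0) +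
        (if i₁ = 2 ∧ i₂ = 2 ∧ i₃ = 3 then p₂ else 0) +
        (if (i₁ = 0 ∧ i₂ = 1 ∧ i₃ = 0) ∨ (i₁ = 1 ∧ i₂ = 0 ∧ i₃ = 0) then -p₀ / 2 else 0) +
        (if (i₁ = 1 ∧ i₂ = 2 ∧ i₃ = 1) ∨ (i₁ = 2 ∧ i₂ = 1 ∧ i₃ = 1) then -p₁ / 2 else 0) +
        (if (i₁ = 2 ∧ i₂ = 3 ∧ i₃ = 2) ∨ (i₁ = 3 ∧ i₂ = 2 ∧ i₃ = 2) then -p₂ / 2 else 0)) :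
    (∀ a b i : Fin 4, a ≠ b → α a b i (0, 0, 1) = 0) ∧
    (∀ a c : Fin 4, α a a c (0, 0, 1) = if a = 3 ∧ c = 0 then (1 : ℝ) else 0) ∧
    (∀ a c : Fin 4, a ≠ c → α a a c (0, 0, 0) =
      (if a = 0 ∧ c = 1 then p₀ else 0) + (if a = 1 ∧ c = 2 then p₁ else 0) + (if a = 2 ∧ c = 3 then p₂ else 0)) ∧
    (∀ a b c : Fin 4, a ≠ b → a ≠ c → b ≠ c → α a b c (0, 0, 0) = 0) := by
  refine ⟨?_, ?_, ?_, ?_⟩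
  · intro a b i hab
    rw [hfeed]
    fin_cases a <;> fin_cases b <;> simp at hab ⊢
  · intro a c
    rw [hfeed]
    fin_cases a <;> fin_cases c <;> simp
  · intro a c hac
    rw [hin]
    fin_cases a <;> fin_cases c <;> simp at hac ⊢
  · intro a b c hab hac hbc
    rw [hin]
    fin_cases a <;> fin_cases b <;> fin_cases c <;> simp at hab hac hbc ⊢

end LadderW

/-- **The tuned weights are admissible**: for `ε₀ ∈ (0, 1]` and `j ≤ 3`,
`(1+ε₀)^{-(15-5j)/8} ∈ [1/4, 1]` (since `2^{15/8} ≤ 4`). [this file] -/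
theorem pumpLadder_tuned_weights {ε₀ : ℝ} (hε : 0 < ε₀) (hε1 : ε₀ ≤ 1) {r : ℝ} (hr0 : 0 ≤ r) (hr : r ≤ 15 / 8) :
    1 / 4 ≤ (1 + ε₀) ^ (-r) ∧ (1 + ε₀) ^ (-r) ≤ 1 := by
  have hb1 : (1 : ℝ) ≤ 1 + ε₀ := by linarith
  have hb2 : 1 + ε₀ ≤ 2 := by linarith
  have hb0 : (0 : ℝ) < 1 + ε₀ := by linarith
  constructor
  · rw [Real.rpow_neg hb0.le]
    have hle : (1 + ε₀) ^ r ≤ 4 := by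
      calc (1 + ε₀) ^ r ≤ (2 : ℝ) ^ r := Real.rpow_le_rpow hb0.le hb2 hr0
        _ ≤ (2 : ℝ) ^ ((2 : ℕ) : ℝ) := Real.rpow_le_rpow_of_exponent_le (by norm_num) (by push_cast; linarith)
        _ = 4 := by rw [Real.rpow_natCast]; norm_num
    have hpos : 0 < (1 + ε₀) ^ r := Real.rpow_pos_of_pos hb0 _
    calc (1 : ℝ) / 4 = 4⁻¹ := by norm_num
      _ ≤ ((1 + ε₀) ^ r)⁻¹ := inv_anti₀ hpos hle
  · exact Real.rpow_le_one_of_one_le_of_nonpos hb1 (by linarith)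

/-- **THE TUNED PUMP LADDER EXISTS INSIDE THE CRUX'S HYPOTHESES AT EVERY SCALE RATIO.**  For every `ε₀ ∈ (0, 1]`
there is a table of `E₂(8)` that is orthant, has diagonal feeds, and has exactly the ladder couplings: pumps
`0→1→2→3` with weights `P_j = (1+ε₀)^{-(15-5j)/8}` and the forward feed `3→0` with weight `1` (no differential
triads) — the hypotheses `hw`, `hP`, `hCz` of `SubOnsagerCeilingKPPumpLadder` — and these weights are TUNED: the
bond coefficient `w_j (1+ε₀)^{5n/2}` of the site `m = 4n+j` equals `c·B^{5m/2}` with `c = (1+ε₀)^{-15/8}`,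
`B = (1+ε₀)^{1/4}`, the coefficient law of the standard Katz–Pavlović chain at ratio `B`. [this file] -/
theorem pumpLadder_nonempty {ε₀ : ℝ} (hε : 0 < ε₀) (hε1 : ε₀ ≤ 1) :
    ∃ α : Fin 4 → Fin 4 → Fin 4 → ℤ × ℤ × ℤ → ℝ, ∃ P₀ P₁ P₂ : ℝ,
    Literature.Analysis.FluidPDE.TaoCascade.InTableClass 8 α ∧
    (∀ (Y : Fin 4 → ℤ → ℝ → ℝ) (τ : ℝ), (∀ (j : Fin 4) (k : ℤ), 1 ≤ k → 0 ≤ Y j k τ) →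
      ∀ δ : ℝ, 0 < δ → ∀ (i : Fin 4) (n : ℤ), 1 ≤ n → Y i n τ = 0 → 0 ≤ quadTerm δ α Y i n τ) ∧
    (∀ a b i : Fin 4, a ≠ b → α a b i (0, 0, 1) = 0) ∧
    (∀ a c : Fin 4, α a a c (0, 0, 1) = if a = 3 ∧ c = 0 then (1 : ℝ) else 0) ∧
    (∀ a c : Fin 4, a ≠ c → α a a c (0, 0, 0) =
      (if a = 0 ∧ c = 1 then P₀ else 0) + (if a = 1 ∧ c = 2 then P₁ else 0) + (if a = 2 ∧ c = 3 then P₂ else 0)) ∧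
    (∀ a b c : Fin 4, a ≠ b → a ≠ c → b ≠ c → α a b c (0, 0, 0) = 0) ∧
    0 < P₀ ∧ 0 < P₁ ∧ 0 < P₂ ∧
    (∀ n : ℤ, P₀ * (1 + ε₀) ^ ((5 : ℝ) * n / 2) =
      (1 + ε₀) ^ (-((15 : ℝ) / 8)) * ((1 + ε₀) ^ ((1 : ℝ) / 4)) ^ ((5 : ℝ) * ((4 * n : ℤ) : ℝ) / 2)) ∧
    (∀ n : ℤ, P₁ * (1 + ε₀) ^ ((5 : ℝ) * n / 2) =
      (1 + ε₀) ^ (-((15 : ℝ) / 8)) * ((1 + ε₀) ^ ((1 : ℝ) / 4)) ^ ((5 : ℝ) * ((4 * n + 1 : ℤ) : ℝ) / 2)) ∧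
    (∀ n : ℤ, P₂ * (1 + ε₀) ^ ((5 : ℝ) * n / 2) =
      (1 + ε₀) ^ (-((15 : ℝ) / 8)) * ((1 + ε₀) ^ ((1 : ℝ) / 4)) ^ ((5 : ℝ) * ((4 * n + 2 : ℤ) : ℝ) / 2)) ∧
    (∀ n : ℤ, (1 : ℝ) * (1 + ε₀) ^ ((5 : ℝ) * n / 2) =
      (1 + ε₀) ^ (-((15 : ℝ) / 8)) * ((1 + ε₀) ^ ((1 : ℝ) / 4)) ^ ((5 : ℝ) * ((4 * n + 3 : ℤ) : ℝ) / 2)) := by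
  have hb0 : (0 : ℝ) < 1 + ε₀ := by linarith
  set p₀ : ℝ := (1 + ε₀) ^ (-((15 : ℝ) / 8)) with hp₀
  set p₁ : ℝ := (1 + ε₀) ^ (-((10 : ℝ) / 8)) with hp₁
  set p₂ : ℝ := (1 + ε₀) ^ (-((5 : ℝ) / 8)) with hp₂
  have w0 := pumpLadder_tuned_weights hε hε1 (r := 15 / 8) (by norm_num) (by norm_num)
  have w1 := pumpLadder_tuned_weights hε hε1 (r := 10 / 8) (by norm_num) (by norm_num)
  have w2 := pumpLadder_tuned_weights hε hε1 (r := 5 / 8) (by norm_num) (by norm_num)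
  set α : Fin 4 → Fin 4 → Fin 4 → ℤ × ℤ × ℤ → ℝ := fun i₁ i₂ i₃ μ =>
    if μ = ((0 : ℤ), (0 : ℤ), (1 : ℤ)) then (if i₁ = 3 ∧ i₂ = 3 ∧ i₃ = 0 then (1 : ℝ) else 0)
    else if μ = ((1 : ℤ), (0 : ℤ), (0 : ℤ)) then (if i₁ = 0 ∧ i₂ = 3 ∧ i₃ = 3 then (-(1 / 2) : ℝ) else 0)
    else if μ = ((0 : ℤ), (1 : ℤ), (0 : ℤ)) then (if i₁ = 3 ∧ i₂ = 0 ∧ i₃ = 3 then (-(1 / 2) : ℝ) else 0)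
    else if μ = ((0 : ℤ), (0 : ℤ), (0 : ℤ)) then
      ((if i₁ = 0 ∧ i₂ = 0 ∧ i₃ = 1 then p₀ else 0) + (if i₁ = 1 ∧ i₂ = 1 ∧ i₃ = 2 then p₁ else 0) +
        (if i₁ = 2 ∧ i₂ = 2 ∧ i₃ = 3 then p₂ else 0) +
        (if (i₁ = 0 ∧ i₂ = 1 ∧ i₃ = 0) ∨ (i₁ = 1 ∧ i₂ = 0 ∧ i₃ = 0) then -p₀ / 2 else 0) +
        (if (i₁ = 1 ∧ i₂ = 2 ∧ i₃ = 1) ∨ (i₁ = 2 ∧ i₂ = 1 ∧ i₃ = 1) then -p₁ / 2 else 0) +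
        (if (i₁ = 2 ∧ i₂ = 3 ∧ i₃ = 2) ∨ (i₁ = 3 ∧ i₂ = 2 ∧ i₃ = 2) then -p₂ / 2 else 0))
    else 0 with hα
  have hfeed : ∀ i₁ i₂ i₃ : Fin 4, α i₁ i₂ i₃ ((0 : ℤ), (0 : ℤ), (1 : ℤ)) =
      if i₁ = 3 ∧ i₂ = 3 ∧ i₃ = 0 then (1 : ℝ) else 0 := by
    intro i₁ i₂ i₃; simp [hα]
  have hup1 : ∀ i₁ i₂ i₃ : Fin 4, α i₁ i₂ i₃ ((1 : ℤ), (0 : ℤ), (0 : ℤ)) =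
      if i₁ = 0 ∧ i₂ = 3 ∧ i₃ = 3 then (-(1 / 2) : ℝ) else 0 := by
    intro i₁ i₂ i₃; simp [hα]
  have hup2 : ∀ i₁ i₂ i₃ : Fin 4, α i₁ i₂ i₃ ((0 : ℤ), (1 : ℤ), (0 : ℤ)) =
      if i₁ = 3 ∧ i₂ = 0 ∧ i₃ = 3 then (-(1 / 2) : ℝ) else 0 := by
    intro i₁ i₂ i₃; simp [hα]
  have hin : ∀ i₁ i₂ i₃ : Fin 4, α i₁ i₂ i₃ ((0 : ℤ), (0 : ℤ), (0 : ℤ)) =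
      (if i₁ = 0 ∧ i₂ = 0 ∧ i₃ = 1 then p₀ else 0) + (if i₁ = 1 ∧ i₂ = 1 ∧ i₃ = 2 then p₁ else 0) +
        (if i₁ = 2 ∧ i₂ = 2 ∧ i₃ = 3 then p₂ else 0) +
        (if (i₁ = 0 ∧ i₂ = 1 ∧ i₃ = 0) ∨ (i₁ = 1 ∧ i₂ = 0 ∧ i₃ = 0) then -p₀ / 2 else 0) +
        (if (i₁ = 1 ∧ i₂ = 2 ∧ i₃ = 1) ∨ (i₁ = 2 ∧ i₂ = 1 ∧ i₃ = 1) then -p₁ / 2 else 0) +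
        (if (i₁ = 2 ∧ i₂ = 3 ∧ i₃ = 2) ∨ (i₁ = 3 ∧ i₂ = 2 ∧ i₃ = 2) then -p₂ / 2 else 0) := by
    intro i₁ i₂ i₃; simp [hα]
  have key : ∀ (a e : ℝ), a + (15 : ℝ) / 8 = e / 4 →
      (1 + ε₀) ^ a = (1 + ε₀) ^ (-((15 : ℝ) / 8)) * ((1 + ε₀) ^ ((1 : ℝ) / 4)) ^ e := by
    intro a e h
    rw [← Real.rpow_mul hb0.le, ← Real.rpow_add hb0]
    congr 1
    linarith
  obtain ⟨hdiag, hw, hP, hCz⟩ := ladderW_struct hfeed hin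
  refine ⟨α, p₀, p₁, p₂, ladderW_inTableClass hfeed hup1 hup2 hin w0 w1 w2,
    ladderW_orthant hfeed hup1 hup2 hin (by linarith [w0.1]) (by linarith [w1.1]) (by linarith [w2.1]),
    hdiag, hw, hP, hCz,
    Real.rpow_pos_of_pos hb0 _, Real.rpow_pos_of_pos hb0 _, Real.rpow_pos_of_pos hb0 _, ?_, ?_, ?_, ?_⟩
  · intro n
    rw [hp₀, ← Real.rpow_add hb0]
    exact key _ _ (by push_cast; ring)
  · intro n
    rw [hp₁, ← Real.rpow_add hb0]
    exact key _ _ (by push_cast; ring)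
  · intro n
    rw [hp₂, ← Real.rpow_add hb0]
    exact key _ _ (by push_cast; ring)
  · intro n
    rw [one_mul]
    exact key _ _ (by push_cast; ring)

end Summit.NavierStokesRegularity.NavierStokesRegularity.Theorems

end
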